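/-
Copyright (c) 2026. All rights reserved.
Released under Apache 2.0 license as described in the file LICENSE.
Authors: abc-iut cell, prover seat abc-iut-L6-t14 (wave 2).
-/
import Mathlib.Algebra.MvPolynomial.PDeriv
import Mathlib.Algebra.MvPolynomial.Monad
import Mathlib.Data.Finsupp.Multiset
import Mathlib.LinearAlgebra.Matrix.Adjugate
import Literature.RingTheory.HenselLemma.NewtonContraction
import HarnessLib

/-!
# Hensel's lemma for square polynomial systems with a non-invertible Jacobian ("positive slope")

Topic `Literature/RingTheory/HenselLemma` (proofs only; no named facts). The sibling file
`NewtonContraction.lean` proves the several-variable Hensel lemma over an `I`-adically complete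
ring `A` when the Jacobian determinant is a UNIT. This file treats the general ("positive slope",
[AbsTopII] Lemma 2.1) case in which the Jacobian determinant `d` is arbitrary, in the classical
form of Bourbaki, *Alg. Comm.* III §4 no. 5, Cor. 2 / Tougeron: a root modulo `d² · I` lifts to a
root congruent modulo `d · I`.  Stated for Taylor polynomials (`exists_eval_det_smul_eq`): for
`S₁, …, S_n ∈ A[Z₁, …, Z_n]` with linear-coefficient matrix `J` and `d = det J`, and any `η ∈ Iⁿ`,
there is `z ∈ Iⁿ` with `S_j(d·z) = S_j(0) + d²·η_j` for all `j`.

Proof: write `S_j = S_j(0) + Σ_i J_{ji} Z_i + Q_j` with `Q_j` of order `≥ 2`; then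
`Q_j(d·Z) = d² Q♯_j(Z)` for a polynomial `Q♯_j` still of order `≥ 2` (`eval_smul_eq_sq_mul_eval_rescaled`), and
`S(d z) = S(0) + d² η` follows from the fixed-point equation `z = adj(J) (η - Q♯(z))`, which the
non-archimedean contraction principle (`existsUnique_fixedPoint_of_contracting`) solves in `Iⁿ`
because polynomials of order `≥ 2` satisfy `Q(z) - Q(z') ∈ I·I^r` for `z ≡ z' (mod I^r)` in `Iⁿ`
(`eval_sub_eval_mem_mul`). Also proved here: the first-order Taylor coefficients of
`p(a + b·Z∘t)` (`coeff_zero_bind₁_affine`, `coeff_single_bind₁_affine`), by induction on `p`, used to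
feed Jacobian hypotheses stated with `MvPolynomial.pderiv` into the Taylor form. Everything is
sorry-free; nothing is asserted.
-/

namespace Literature.RingTheory.HenselLemma

open MvPolynomial Finsupp Matrix

variable {R : Type*} [CommRing R]

/-! ### Monomials of order at least two, modulo ideals -/

section Order

variable {σ : Type*}

/-- If every factor difference `z_i - z'_i` lies in `J`, so does `∏_m z - ∏_m z'` for any multiset
of indices `m`. [folklore] -/
private theorem multiset_prod_map_sub_mem (J : Ideal R) (z z' : σ → R) (hJ : ∀ i, z i - z' i ∈ J)
    (m : Multiset σ) : (m.map z).prod - (m.map z').prod ∈ J := by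
  induction m using Multiset.induction_on with
  | empty => simp
  | cons i m ih =>
    rw [Multiset.map_cons, Multiset.map_cons, Multiset.prod_cons, Multiset.prod_cons]
    have : z i * (m.map z).prod - z' i * (m.map z').prod =
        z i * ((m.map z).prod - (m.map z').prod) + (z i - z' i) * (m.map z').prod := by ring
    rw [this]
    exact J.add_mem (J.mul_mem_left _ ih) (J.mul_mem_right _ (hJ i))

/-- A nonempty product of elements of `I` lies in `I`. [folklore] -/
private theorem multiset_prod_map_mem (I : Ideal R) (z : σ → R) (hI : ∀ i, z i ∈ I)
    (m : Multiset σ) (hm : m ≠ 0) : (m.map z).prod ∈ I := by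
  induction m using Multiset.induction_on with
  | empty => exact absurd rfl hm
  | cons i m _ =>
    rw [Multiset.map_cons, Multiset.prod_cons]
    exact I.mul_mem_right _ (hI i)

/-- With at least two factors, all in `I`, and factor differences in `J`, the difference of the
products lies in `I * J`. [folklore] -/
private theorem multiset_prod_map_sub_mem_mul (I J : Ideal R) (z z' : σ → R) (hI : ∀ i, z i ∈ I)
    (hI' : ∀ i, z' i ∈ I) (hJ : ∀ i, z i - z' i ∈ J) (m : Multiset σ) (hm : 2 ≤ Multiset.card m) :
    (m.map z).prod - (m.map z').prod ∈ I * J := by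
  induction m using Multiset.induction_on with
  | empty => simp at hm
  | cons i m _ =>
    rw [Multiset.map_cons, Multiset.map_cons, Multiset.prod_cons, Multiset.prod_cons]
    have hm0 : m ≠ 0 := by
      rintro rfl
      simp at hm
    have : z i * (m.map z).prod - z' i * (m.map z').prod =
        z i * ((m.map z).prod - (m.map z').prod) + (m.map z').prod * (z i - z' i) := by ring
    rw [this]
    exact (I * J).add_mem (Ideal.mul_mem_mul (hI i) (multiset_prod_map_sub_mem J z z' hJ m))
      (Ideal.mul_mem_mul (multiset_prod_map_mem I z' hI' m hm0) (hJ i))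

/-- The monomial `z^α = ∏_{i ∈ supp α} z_i^{α i}` as a product over the multiset of `α`.
[folklore] -/
private theorem prod_pow_eq_multiset_prod (α : σ →₀ ℕ) (z : σ → R) :
    (∏ i ∈ α.support, z i ^ α i) = ((toMultiset α).map z).prod := by
  rw [toMultiset_map, prod_toMultiset,
    Finsupp.prod_mapDomain_index (h := fun a n => a ^ n) (fun _ => pow_zero _)
      (fun _ _ _ => pow_add _ _ _)]
  rfl

/-- `Finsupp.toMultiset` is injective. [folklore] -/
private theorem finsupp_toMultiset_inj {α β : σ →₀ ℕ} (h : toMultiset α = toMultiset β) : α = β := by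
  classical
  rw [← Finsupp.toMultiset_toFinsupp α, ← Finsupp.toMultiset_toFinsupp β, h]

/-- A monomial exponent that is neither `0` nor some `single i 1` has at least two factors
(i.e. degree `≥ 2`). [folklore] -/
private theorem two_le_card_toMultiset (α : σ →₀ ℕ) (h0 : α ≠ 0) (h1 : ∀ i, α ≠ Finsupp.single i 1) :
    2 ≤ Multiset.card (toMultiset α) := by
  by_contra hlt
  have hle : Multiset.card (toMultiset α) ≤ 1 := by omega
  rcases Nat.le_one_iff_eq_zero_or_eq_one.mp hle with h | h
  · apply h0
    apply finsupp_toMultiset_inj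
    rw [toMultiset_zero]
    exact Multiset.card_eq_zero.mp h
  · obtain ⟨i, hi⟩ := Multiset.card_eq_one.mp h
    apply h1 i
    apply finsupp_toMultiset_inj
    rw [hi, toMultiset_single, one_nsmul]

/-- **Order-two estimate.** If `Q` has no constant and no linear terms, `z, z'` have coordinates
in `I` and `z - z'` has coordinates in `J`, then `Q(z) - Q(z') ∈ I * J`. [folklore] -/
private theorem eval_sub_eval_mem_mul (I J : Ideal R) (Q : MvPolynomial σ R)
    (h0 : coeff 0 Q = 0) (h1 : ∀ i, coeff (Finsupp.single i 1) Q = 0)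
    (z z' : σ → R) (hI : ∀ i, z i ∈ I) (hI' : ∀ i, z' i ∈ I) (hJ : ∀ i, z i - z' i ∈ J) :
    eval z Q - eval z' Q ∈ I * J := by
  rw [eval_eq, eval_eq, ← Finset.sum_sub_distrib]
  refine Submodule.sum_mem _ fun α hα => ?_
  rw [← mul_sub, prod_pow_eq_multiset_prod, prod_pow_eq_multiset_prod]
  refine Ideal.mul_mem_left _ _ (multiset_prod_map_sub_mem_mul I J z z' hI hI' hJ _ ?_)
  refine two_le_card_toMultiset α ?_ ?_
  · rintro rfl
    exact (MvPolynomial.mem_support_iff.mp hα) h0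
  · rintro i rfl
    exact (MvPolynomial.mem_support_iff.mp hα) (h1 i)

/-- Special case `z' = 0` of `eval_sub_eval_mem_mul`: `Q(z) ∈ I * I`. [folklore] -/
private theorem eval_mem_mul_self (I : Ideal R) (Q : MvPolynomial σ R)
    (h0 : coeff 0 Q = 0) (h1 : ∀ i, coeff (Finsupp.single i 1) Q = 0)
    (z : σ → R) (hI : ∀ i, z i ∈ I) : eval z Q ∈ I * I := by
  have h := eval_sub_eval_mem_mul I I Q h0 h1 z 0 hI (fun _ => I.zero_mem)
    (fun i => by rw [Pi.zero_apply, sub_zero]; exact hI i)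
  have hz : eval (0 : σ → R) Q = 0 := by
    rw [eval_zero]
    exact h0
  rwa [hz, sub_zero] at h

end Order

/-! ### First-order Taylor coefficients of `p(a + b·Z∘t)` -/

section Taylor

variable {σ τ : Type*}

/-- `taylorAt` on constants: `C c (a + b·Z∘t) = C c`. [folklore] -/
private theorem taylorAt_C (a b : σ → R) (t : σ → τ) (c : R) :
    bind₁ (fun i => C (a i) + C (b i) * X (t i)) (C c : MvPolynomial σ R) = C c := by
  simp

/-- the substitution is additive. [folklore] -/
private theorem taylorAt_add (a b : σ → R) (t : σ → τ) (p q : MvPolynomial σ R) :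
    bind₁ (fun i => C (a i) + C (b i) * X (t i)) (p + q) =
      bind₁ (fun i => C (a i) + C (b i) * X (t i)) p +
        bind₁ (fun i => C (a i) + C (b i) * X (t i)) q := by
  simp

/-- the substitution on `p · X_j`. [folklore] -/
private theorem taylorAt_mul_X (a b : σ → R) (t : σ → τ) (p : MvPolynomial σ R) (j : σ) :
    bind₁ (fun i => C (a i) + C (b i) * X (t i)) (p * X j) =
      C (a j) * bind₁ (fun i => C (a i) + C (b i) * X (t i)) p +
        C (b j) * bind₁ (fun i => C (a i) + C (b i) * X (t i)) p * X (t j) := by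
  simp only [map_mul, bind₁_X_right]
  ring

/-- Evaluating `p(a + b·Z∘t)` at `z` is evaluating `p` at `a + b · (z ∘ t)` (substitution in the
Taylor expansion). [cite: Bourbaki1989CommAlg, Ch. III §4 no. 5] -/
theorem eval_bind₁_affine (a b : σ → R) (t : σ → τ) (p : MvPolynomial σ R) (z : τ → R) :
    eval z (bind₁ (fun i => C (a i) + C (b i) * X (t i)) p) =
      eval (fun i => a i + b i * z (t i)) p := by
  show eval₂Hom (RingHom.id R) z (bind₁ _ p) = _
  rw [eval₂Hom_bind₁]
  show eval (fun i => eval z (C (a i) + C (b i) * X (t i))) p = _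
  have h : (fun i => eval z (C (a i) + C (b i) * X (t i))) = fun i => a i + b i * z (t i) := by
    funext i
    simp
  rw [h]

/-- **Taylor, order 0**: the constant coefficient of `p(a + b·Z∘t)` is `p(a)`.
[cite: Bourbaki1989CommAlg, Ch. III §4 no. 5] -/
theorem coeff_zero_bind₁_affine [DecidableEq τ] (a b : σ → R) (t : σ → τ)
    (p : MvPolynomial σ R) :
    coeff 0 (bind₁ (fun i => C (a i) + C (b i) * X (t i)) p) = eval a p := by
  induction p using MvPolynomial.induction_on with
  | C c => simp
  | add p q hp hq => rw [taylorAt_add, coeff_add, hp, hq, map_add]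
  | mul_X p j hp =>
    rw [taylorAt_mul_X, coeff_add, coeff_C_mul, coeff_mul_X', hp, map_mul, eval_X]
    simp [mul_comm]

/-- **Taylor, order 1**: the coefficient of `Z_k` in `p(a + b·Z∘t)` is
`∑_{i : t i = k} b_i · (∂p/∂X_i)(a)` (first-order Taylor formula for polynomials).
[cite: Bourbaki1989CommAlg, Ch. III §4 no. 5] -/
theorem coeff_single_bind₁_affine [Fintype σ] [DecidableEq σ] [DecidableEq τ] (a b : σ → R)
    (t : σ → τ) (p : MvPolynomial σ R) (k : τ) :
    coeff (Finsupp.single k 1) (bind₁ (fun i => C (a i) + C (b i) * X (t i)) p) =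
      ∑ i ∈ Finset.univ.filter (fun i => t i = k), b i * eval a (pderiv i p) := by
  induction p using MvPolynomial.induction_on with
  | C c =>
    rw [taylorAt_C, coeff_C, if_neg (Finsupp.single_ne_zero.mpr one_ne_zero).symm]
    simp
  | add p q hp hq =>
    rw [taylorAt_add, coeff_add, hp, hq, ← Finset.sum_add_distrib]
    refine Finset.sum_congr rfl fun i _ => ?_
    rw [map_add, map_add, mul_add]
  | mul_X p j hp =>
    rw [taylorAt_mul_X, coeff_add, coeff_C_mul, hp, coeff_mul_X']
    have hsupp : (t j ∈ (Finsupp.single k 1).support) ↔ t j = k := by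
      rw [Finsupp.mem_support_iff, Finsupp.single_apply]
      constructor
      · intro h
        by_contra hne
        exact h (if_neg (Ne.symm hne))
      · intro h
        rw [if_pos h.symm]
        exact one_ne_zero
    simp only [hsupp]
    have hR : ∀ i, b i * eval a (pderiv i (p * X j)) =
        a j * (b i * eval a (pderiv i p)) + (if i = j then b i * eval a p else 0) := by
      intro i
      rw [pderiv_mul, map_add, map_mul, map_mul, eval_X, pderiv_X]
      by_cases hij : i = j
      · subst hij
        rw [if_pos rfl, Pi.single_eq_same, map_one]
        ring
      · rw [if_neg hij, Pi.single_eq_of_ne (Ne.symm hij), map_zero]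
        ring
    simp_rw [hR, Finset.sum_add_distrib, ← Finset.mul_sum]
    congr 1
    rw [Finset.sum_ite_eq']
    by_cases htj : t j = k
    · have hmem : j ∈ Finset.univ.filter (fun i => t i = k) :=
        Finset.mem_filter.mpr ⟨Finset.mem_univ _, htj⟩
      rw [if_pos htj, if_pos hmem, htj, tsub_self, coeff_C_mul, coeff_zero_bind₁_affine]
    · have hmem : j ∉ Finset.univ.filter (fun i => t i = k) :=
        fun h => htj (Finset.mem_filter.mp h).2
      rw [if_neg htj, if_neg hmem]

end Taylor

/-! ### Square systems with arbitrary Jacobian determinant -/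

section Square

variable {n : Type*} [Fintype n] [DecidableEq n]

/-- `Q_j := S_j - S_j(0) - Σ_i J_{ji} Z_i` has no constant term. [folklore] -/
private theorem coeff_zero_higherPart (p : MvPolynomial n R) (c : n → R) :
    coeff 0 (p - C (coeff 0 p) - ∑ i, C (c i) * X i) = 0 := by
  simp [coeff_sum, coeff_C_mul, coeff_zero_X]

/-- with `c_i = coeff_{Z_i}(p)`, `Q` has no linear terms. [folklore] -/
private theorem coeff_single_higherPart (p : MvPolynomial n R) (c : n → R)
    (hc : ∀ i, c i = coeff (Finsupp.single i 1) p) (i : n) :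
    coeff (Finsupp.single i 1) (p - C (coeff 0 p) - ∑ i, C (c i) * X i) = 0 := by
  simp only [coeff_sub, coeff_sum, coeff_C_mul, coeff_C, coeff_X,
    Finsupp.single_left_inj (one_ne_zero : (1 : ℕ) ≠ 0)]
  rw [if_neg (Finsupp.single_ne_zero.mpr one_ne_zero).symm, sub_zero]
  simp [Finset.sum_ite_eq', hc]

omit [DecidableEq n] in
/-- `p(w) = p(0) + Σ_i c_i w_i + Q(w)`. [folklore] -/
private theorem eval_eq_of_higherPart (p : MvPolynomial n R) (c : n → R) (w : n → R) :
    eval w p = coeff 0 p + ∑ i, c i * w i + eval w (p - C (coeff 0 p) - ∑ i, C (c i) * X i) := by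
  have : p = C (coeff 0 p) + (∑ i, C (c i) * X i) + (p - C (coeff 0 p) - ∑ i, C (c i) * X i) := by
    ring
  conv_lhs => rw [this]
  simp only [map_add, map_sum, map_mul, eval_C, eval_X]

omit [Fintype n] in
/-- Coefficients of the rescaled polynomial `Q♯ = Σ_α (coeff_α Q · d^{|α|-2}) Z^α`. [folklore] -/
private theorem coeff_rescaled (Q : MvPolynomial n R) (d : R) (β : n →₀ ℕ) :
    coeff β (∑ α ∈ Q.support, monomial α (coeff α Q * d ^ (Multiset.card (toMultiset α) - 2))) =
      if β ∈ Q.support then coeff β Q * d ^ (Multiset.card (toMultiset β) - 2) else 0 := by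
  rw [coeff_sum]
  simp_rw [coeff_monomial]
  rw [Finset.sum_ite_eq']

omit [Fintype n] in
/-- `Q♯` has no constant term if `Q` has none. [folklore] -/
private theorem coeff_zero_rescaled (Q : MvPolynomial n R) (d : R) (h0 : coeff 0 Q = 0) :
    coeff 0 (∑ α ∈ Q.support, monomial α (coeff α Q * d ^ (Multiset.card (toMultiset α) - 2)))
      = 0 := by
  rw [coeff_rescaled]
  split_ifs with h
  · rw [h0, zero_mul]
  · rfl

omit [Fintype n] in
/-- `Q♯` has no linear terms if `Q` has none. [folklore] -/
private theorem coeff_single_rescaled (Q : MvPolynomial n R) (d : R) (i : n)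
    (h1 : coeff (Finsupp.single i 1) Q = 0) :
    coeff (Finsupp.single i 1)
      (∑ α ∈ Q.support, monomial α (coeff α Q * d ^ (Multiset.card (toMultiset α) - 2))) = 0 := by
  rw [coeff_rescaled]
  split_ifs with h
  · rw [h1, zero_mul]
  · rfl

omit [Fintype n] [DecidableEq n] in
/-- `Q(d·z) = d² · Q♯(z)` when `Q` has order `≥ 2`. [folklore] -/
private theorem eval_smul_eq_sq_mul_eval_rescaled (Q : MvPolynomial n R) (d : R)
    (h0 : coeff 0 Q = 0) (h1 : ∀ i, coeff (Finsupp.single i 1) Q = 0) (z : n → R) :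
    eval (d • z) Q = d ^ 2 *
      eval z (∑ α ∈ Q.support, monomial α (coeff α Q * d ^ (Multiset.card (toMultiset α) - 2))) := by
  rw [map_sum, Finset.mul_sum, eval_eq]
  refine Finset.sum_congr rfl fun α hα => ?_
  rw [eval_monomial]
  have hdeg : 2 ≤ Multiset.card (toMultiset α) := by
    refine two_le_card_toMultiset α ?_ ?_
    · rintro rfl
      exact (MvPolynomial.mem_support_iff.mp hα) h0
    · rintro i rfl
      exact (MvPolynomial.mem_support_iff.mp hα) (h1 i)
  have hprod : (∏ i ∈ α.support, (d • z) i ^ α i) =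
      d ^ Multiset.card (toMultiset α) * ∏ i ∈ α.support, z i ^ α i := by
    simp_rw [Pi.smul_apply, smul_eq_mul, mul_pow, Finset.prod_mul_distrib,
      Finset.prod_pow_eq_pow_sum, card_toMultiset]
    rfl
  rw [hprod]
  have hpow : d ^ Multiset.card (toMultiset α) =
      d ^ 2 * d ^ (Multiset.card (toMultiset α) - 2) := by
    rw [← pow_add, Nat.add_sub_cancel' hdeg]
  rw [hpow]
  show _ = d ^ 2 * (coeff α Q * d ^ _ * α.prod fun i k => z i ^ k)
  rw [Finsupp.prod]
  ring

/-- **Hensel's lemma for square systems with arbitrary Jacobian determinant, Taylor form**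
(Bourbaki, *Alg. Comm.* III §4 no. 5, Cor. 2; [AbsTopII] Lemma 2.1 "positive slope"): let
`S₁, …, S_n` be polynomials in `n` variables over an `I`-adically complete ring,
`J = (coeff_{Z_i} S_j)_{ji}` the matrix of their linear coefficients and `d = det J` (not assumed
to be a unit). Then for every `η ∈ Iⁿ` there is `z ∈ Iⁿ` with `S_j(d·z) = S_j(0) + d²·η_j` for
all `j`. [cite: Bourbaki1989CommAlg, Ch. III §4 no. 5 Cor. 2] -/
theorem exists_eval_det_smul_eq {I : Ideal R} [IsAdicComplete I R] (S : n → MvPolynomial n R)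
    (η : n → R) (hη : ∀ j, η j ∈ I) :
    ∃ z : n → R, (∀ i, z i ∈ I) ∧
      ∀ j, eval ((Matrix.of fun j i => coeff (Finsupp.single i 1) (S j)).det • z) (S j) =
        coeff 0 (S j) + (Matrix.of fun j i => coeff (Finsupp.single i 1) (S j)).det ^ 2 * η j := by
  set J : Matrix n n R := Matrix.of fun j i => coeff (Finsupp.single i 1) (S j) with hJ
  set d := J.det
  -- order-`≥ 2` parts and their rescalings
  let Q : n → MvPolynomial n R := fun j => S j - C (coeff 0 (S j)) - ∑ i, C (J j i) * X i
  have hQ0 : ∀ j, coeff 0 (Q j) = 0 := fun j => coeff_zero_higherPart (S j) (J j)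
  have hQ1 : ∀ j i, coeff (Finsupp.single i 1) (Q j) = 0 := fun j i =>
    coeff_single_higherPart (S j) (J j) (fun i => rfl) i
  let Q' : n → MvPolynomial n R := fun j =>
    ∑ α ∈ (Q j).support, monomial α (coeff α (Q j) * d ^ (Multiset.card (toMultiset α) - 2))
  have hQ'0 : ∀ j, coeff 0 (Q' j) = 0 := fun j => coeff_zero_rescaled (Q j) d (hQ0 j)
  have hQ'1 : ∀ j i, coeff (Finsupp.single i 1) (Q' j) = 0 := fun j i =>
    coeff_single_rescaled (Q j) d i (hQ1 j i)
  -- the Newton-type map `T z = adj(J) (η - Q♯(z))` is a contraction of `Iⁿ`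
  let T : (n → R) → (n → R) := fun z => adjugate J *ᵥ (η - fun j => eval z (Q' j))
  have hT₀ : ∀ c : n → R, (∀ p, c p ∈ I) → ∀ p, T c p ∈ I := by
    intro c hc p
    refine mulVec_mem (adjugate J) (fun j => I.sub_mem (hη j) ?_) p
    exact Ideal.mul_le_right (eval_mem_mul_self I (Q' j) (hQ'0 j) (hQ'1 j) c hc)
  have hT : ∀ (r : ℕ) (c c' : n → R), (∀ p, c p ∈ I) → (∀ p, c' p ∈ I) →
      (∀ p, c p - c' p ∈ I ^ r) → ∀ p, T c p - T c' p ∈ I ^ (r + 1) := by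
    intro r c c' hc hc' hcc' p
    have hsub : T c - T c' = adjugate J *ᵥ fun j => eval c' (Q' j) - eval c (Q' j) := by
      simp only [T]
      rw [← Matrix.mulVec_sub]
      congr 1
      funext j
      simp only [Pi.sub_apply]
      ring
    rw [← Pi.sub_apply, hsub]
    refine mulVec_mem (adjugate J) (fun j => ?_) p
    rw [pow_succ', ← neg_sub, Ideal.neg_mem_iff]
    exact eval_sub_eval_mem_mul I (I ^ r) (Q' j) (hQ'0 j) (hQ'1 j) c c' hc hc' hcc'
  obtain ⟨z, ⟨hzI, hfix⟩, -⟩ := existsUnique_fixedPoint_of_contracting I T hT₀ hT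
  refine ⟨z, hzI, fun j => ?_⟩
  -- from the fixed point: `J z = d (η - Q♯ z)`
  have hJz : J *ᵥ z = d • (η - fun j => eval z (Q' j)) := by
    conv_lhs => rw [← hfix]
    simp only [T]
    rw [Matrix.mulVec_mulVec, Matrix.mul_adjugate, Matrix.smul_mulVec, Matrix.one_mulVec]
  have hJzj : ∑ i, J j i * (d • z) i = d * (d * (η j - eval z (Q' j))) := by
    have := congrFun hJz j
    simp only [Matrix.mulVec, dotProduct, Pi.smul_apply, smul_eq_mul, Pi.sub_apply] at this
    simp_rw [Pi.smul_apply, smul_eq_mul, ← mul_assoc, mul_comm (J j _) d, mul_assoc,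
      ← Finset.mul_sum, this]
  rw [eval_eq_of_higherPart (S j) (J j), hJzj,
    eval_smul_eq_sq_mul_eval_rescaled (Q j) d (hQ0 j) (hQ1 j)]
  ring

end Square

end Literature.RingTheory.HenselLemma
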